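import Summits.Parity.BatemanHorn.Theorems.RoughParitySectorsOddSectorShareLinearSieveDecouplingPrimeAux1
import Summits.Parity.BatemanHorn.Theorems.RoughParitySectorsOddSectorShareLinearSieveDecouplingPrimeAux2
import HarnessLib

/-!
# Route `RoughParitySectors`, crux `OddSectorShareLinear` (stmt-Parity-15629), line `birth`:
# helpers III for the stub `stub_sieveDecouplingPrime` — the decoupling sieve at a fixed height

`--supports stmt-Parity-15629`.  At a fixed height `x`, sifting level `z' ≥ 2` (`z = ⌈z'⌉`) and level
of distribution `D ≥ z'`, the `(k−1)`-dimensional sieve of the stub S'a is carried out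
(`SieveDecoupling.sieve_at`): the sequence `𝒜 = {1 ≤ n ≤ x : f_m(n) prime ≥ z}` (`f_m = αX + β`),
encoded by `N(n) = ∏_{p < z, n mod p ∈ Ω p} p` and sifted by the primes `< z`, has
`S(𝒜, z) = P + O(n₀)` (`P` = member `m`'s prime cell inside the jointly rough set), main term
`X V(z)` with `X = (π(αx+β) − π(z−1))/φ(α)`, `V(z) = W = ∏_{p<z} (1 − #Ω p/#Φ p)`, and remainders
`|R_d| ≤ S^{ω(d)} E_π(αx+β; αd) + d z` (classes `c mod d` of `𝒜` are classes `αc + β mod αd` of the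
primes, `Aux2`; `φ(αd) = φ(α) ∏_{p ∣ d} #Φ p`, `Aux1`).  With the tree's uniform Fundamental Lemma
(constant `C₀`) this gives the inequality
`|P − W Q| ≤ n₀ + C₀ e^{−log D/log z'} W (Q + E₁) + (∑_{d ∣ P(z), d ≤ D} S^{ω(d)} E_π(αx+β; αd) + D² z) + W E₁`,
`E₁ = E_π(αx+β; α) + z`, `Q = #𝒜`, consumed by the stub file.
-/

noncomputable section

open Filter Finset Polynomial
open scoped BigOperators
open Literature.NumberTheory.Sieve

namespace Summit.Parity.BatemanHorn.Cruxes.OddSectorShareLinear.Birth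

namespace SieveDecoupling

open IntervalClassSieve (prime_dvd_classProd_iff classProd_pos classProd_le dvd_iff_forall_primeFactors)

variable {k : ℕ} {f : Fin k → ℤ[X]} {m : Fin k} {Ω Φ : ℕ → Finset ℕ} {α β : ℤ}

/-- **The remainder of the decoupling sieve at a squarefree modulus.**  For `d` squarefree with all
prime factors `< z`, the count `#{n ∈ 𝒜 : n mod q ∈ Ω q ∀ q ∣ d}` is within
`S^{ω(d)} E_π(αx+β; αd) + d z` of `g(d) X`, `X = (π(αx+β) − π(z−1))/φ(α)` (split over the
`∏ #Ω q ≤ S^{ω(d)}` admissible classes `c mod d`, each a reduced class `αc + β mod αd` of the primes,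
and `φ(αd) = φ(α) ∏ #Φ q`). [folklore] -/
theorem abs_card_classes_sub_le (hf : IsBatemanHornSystem f)
    (hΩ : ∀ p, Ω p = (range p).filter (fun c : ℕ => ¬ ((p : ℤ) ∣ (f m).eval (c : ℤ)) ∧
      ∃ i, i ≠ m ∧ (p : ℤ) ∣ (f i).eval (c : ℤ)))
    (hΦ : ∀ p, Φ p = (range p).filter (fun c : ℕ => ¬ ((p : ℤ) ∣ (f m).eval (c : ℤ))))
    (hα : 0 < α) (hfm : ∀ n : ℤ, (f m).eval n = α * n + β)
    (hαβ : ∀ p : ℕ, p.Prime → (p : ℤ) ∣ α → ¬ ((p : ℤ) ∣ β))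
    {g : ArithmeticFunction ℝ}
    (hg : ∀ d : ℕ, d ≠ 0 → g d = ∏ p ∈ d.primeFactors, (#(Ω p) : ℝ) / (#(Φ p) : ℝ))
    {S : ℕ} (hS : ∀ p : ℕ, p.Prime → #(Ω p) ≤ S)
    {x z d : ℕ} (hd : Squarefree d) (hzβ : β < z) (hx : 0 ≤ α * x + β)
    (hzy : z ≤ (α * x + β).toNat + 1) :
    |(#(((Icc 1 x).filter (fun n : ℕ => (0 < α * n + β ∧
        ∀ p ∈ range z, p.Prime → ¬ ((p : ℤ) ∣ α * n + β)) ∧ ArithmeticFunction.cardFactors (α * n + β).toNat = 1)).filter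
        (fun n : ℕ => ∀ q ∈ d.primeFactors, n % q ∈ Ω q)) : ℝ) -
        g d * (((Nat.primeCounting (α * x + β).toNat : ℝ) - Nat.primeCounting (z - 1)) /
          Nat.totient α.toNat)| ≤
      (S : ℝ) ^ ArithmeticFunction.cardDistinctFactors d * primeCountingAPErr (((α * x + β).toNat : ℕ) : ℝ) (α.toNat * d) + d * z := by
  have hd0 : d ≠ 0 := hd.ne_zero
  have hα'0 : 0 < α.toNat := by omega
  haveI : NeZero (α.toNat * d) := ⟨Nat.mul_ne_zero hα'0.ne' hd0⟩
  set y : ℕ := (α * x + β).toNat with hy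
  set T := (Icc 1 x).filter (fun n : ℕ => (0 < α * n + β ∧
      ∀ p ∈ range z, p.Prime → ¬ ((p : ℤ) ∣ α * n + β)) ∧ ArithmeticFunction.cardFactors (α * n + β).toNat = 1) with hT
  set Cd := (range d).filter (fun c => ∀ q ∈ d.primeFactors, c % q ∈ Ω q) with hCd
  set Md : ℝ := ((Nat.primeCounting y : ℝ) - Nat.primeCounting (z - 1)) / Nat.totient (α.toNat * d)
    with hMd
  set E : ℝ := primeCountingAPErr (y : ℝ) (α.toNat * d) with hE
  -- the classwise estimate
  have hclass : ∀ c ∈ Cd, |(#(T.filter (fun n : ℕ => n % d = c)) : ℝ) - Md| ≤ E + z := by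
    intro c hc
    rw [hCd, mem_filter, mem_range] at hc
    obtain ⟨hcd, hcΩ⟩ := hc
    have hc' : ∀ q ∈ d.primeFactors, ¬ ((q : ℤ) ∣ α * c + β) := by
      intro q hq hdvd
      have h1 := hcΩ q hq
      rw [hΩ, mem_filter] at h1
      refine h1.2.1 ?_
      rw [← dvd_eval_iff_dvd_eval_mod, hfm]
      exact hdvd
    obtain ⟨u, hu⟩ := isUnit_linear_class hα hαβ hd0 hc'
    have ha : (((u : ZMod (α.toNat * d)).val : ℕ) : ZMod (α.toNat * d)) =
        ((α * c + β : ℤ) : ZMod (α.toNat * d)) := by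
      rw [ZMod.natCast_zmod_val, hu]
    rw [card_filter_mod_eq hα hcd hzβ hx ha]
    exact abs_card_sub_le hzy u
  -- the main term `g(d) X = #Cd · Md`
  have hCd_card : (#Cd : ℝ) = ∏ q ∈ d.primeFactors, (#(Ω q) : ℝ) := by
    rw [hCd, card_classes_eq_prod Ω (fun p _ => lt_of_mem_Ω hΩ p) hd, Nat.cast_prod]
  have hΦpos : ∀ q ∈ d.primeFactors, (0 : ℝ) < #(Φ q) := fun q hq => by
    exact_mod_cast (Nat.zero_le _).trans_lt
      (card_Ω_lt_card_Φ hf hΩ hΦ (Nat.prime_of_mem_primeFactors hq))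
  have hprodpos : (0 : ℝ) < ∏ q ∈ d.primeFactors, (#(Φ q) : ℝ) := prod_pos hΦpos
  have hφpos : (0 : ℝ) < Nat.totient α.toNat := by exact_mod_cast Nat.totient_pos.mpr hα'0
  have hmain : g d * (((Nat.primeCounting y : ℝ) - Nat.primeCounting (z - 1)) / Nat.totient α.toNat) =
      #Cd * Md := by
    rw [hMd, totient_mul_eq hΦ hα hfm hαβ hd, hg d hd0, prod_div_distrib, hCd_card]
    ring
  -- split over the classes and sum the classwise estimates
  have hsplit : (#(T.filter (fun n : ℕ => ∀ q ∈ d.primeFactors, n % q ∈ Ω q)) : ℝ) =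
      ∑ c ∈ Cd, (#(T.filter (fun n : ℕ => n % d = c)) : ℝ) := by
    rw [card_filter_forall_mem_eq_sum T Ω hd0, Nat.cast_sum]
  have hCdS : (#Cd : ℝ) ≤ (S : ℝ) ^ ArithmeticFunction.cardDistinctFactors d := by
    have h1 : #Cd ≤ S ^ ArithmeticFunction.cardDistinctFactors d := by
      rw [hCd, card_classes_eq_prod Ω (fun p _ => lt_of_mem_Ω hΩ p) hd]
      exact prod_card_le_pow Ω hS d
    exact_mod_cast h1
  have hCdd : (#Cd : ℝ) ≤ d := by exact_mod_cast card_classes_le Ω d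
  have hE0 : 0 ≤ E := primeCountingAPErr_nonneg _ _
  rw [hmain, hsplit, show (#Cd : ℝ) * Md = ∑ c ∈ Cd, Md by rw [sum_const, nsmul_eq_mul],
    ← sum_sub_distrib]
  calc |∑ c ∈ Cd, ((#(T.filter (fun n : ℕ => n % d = c)) : ℝ) - Md)|
      ≤ ∑ c ∈ Cd, |(#(T.filter (fun n : ℕ => n % d = c)) : ℝ) - Md| := abs_sum_le_sum_abs _ _
    _ ≤ ∑ c ∈ Cd, (E + z) := sum_le_sum hclass
    _ = #Cd * (E + z) := by rw [sum_const, nsmul_eq_mul]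
    _ = #Cd * E + #Cd * z := by ring
    _ ≤ (S : ℝ) ^ ArithmeticFunction.cardDistinctFactors d * E + d * z := add_le_add (mul_le_mul_of_nonneg_right hCdS hE0)
        (mul_le_mul_of_nonneg_right hCdd (Nat.cast_nonneg _))

/-- **The decoupling sieve at a fixed height.**  With the uniform Fundamental Lemma (constant `C₀`)
for the dimension data `(κ, K)` of the density `g(d) = ∏_{p ∣ d} #Ω p/#Φ p`, sifting level
`z' ≥ 2` (`z = ⌈z'⌉ > β`), level of distribution `D ≥ z'` and `z ≤ αx + β + 1`:
`|P − W Q| ≤ n₀ + C₀ e^{−log D/log z'} W (Q + E₁) + (∑_{d ∣ P(z'), d ≤ D} S^{ω(d)} E_π(αx+β; αd) + D² z) + W E₁`,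
where `P` is member `m`'s prime cell inside the jointly `z`-rough set, `Q = #{n ≤ x : f_m(n) prime ≥ z}`,
`W = ∏_{p < z} (1 − g(p))`, `E₁ = E_π(αx+β; α) + z` (sequence `a_v = #{n ∈ 𝒜 : N(n) = v}`,
`N(n) = ∏_{p<z, n mod p ∈ Ω p} p`, size `(π(αx+β) − π(z−1))/φ(α)`; `S(𝒜, z) = P + O(n₀)`,
`abs_card_classes_sub_le` for the remainders, the class `0 mod 1` for `Q`). [folklore] -/
theorem sieve_at (hf : IsBatemanHornSystem f)
    (hΩ : ∀ p, Ω p = (range p).filter (fun c : ℕ => ¬ ((p : ℤ) ∣ (f m).eval (c : ℤ)) ∧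
      ∃ i, i ≠ m ∧ (p : ℤ) ∣ (f i).eval (c : ℤ)))
    (hΦ : ∀ p, Φ p = (range p).filter (fun c : ℕ => ¬ ((p : ℤ) ∣ (f m).eval (c : ℤ))))
    (hα : 0 < α) (hfm : ∀ n : ℤ, (f m).eval n = α * n + β)
    (hαβ : ∀ p : ℕ, p.Prime → (p : ℤ) ∣ α → ¬ ((p : ℤ) ∣ β))
    {g : ArithmeticFunction ℝ}
    (hg : ∀ d : ℕ, d ≠ 0 → g d = ∏ p ∈ d.primeFactors, (#(Ω p) : ℝ) / (#(Φ p) : ℝ))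
    {κ K C₀ : ℝ} (hdim : HasSieveDimension g κ K) (hC₀ : 0 ≤ C₀)
    (hFL : ∀ A : SieveSequence, HasSieveDimension A.density κ K → ∀ x z D : ℝ, 2 ≤ z → z ≤ D →
      0 ≤ A.size x →
      |A.sifted x (primesProdBelow z) - A.size x * A.densityProduct (primesProdBelow z)| ≤
        C₀ * A.size x * A.densityProduct (primesProdBelow z) *
            Real.exp (-(Real.log D / Real.log z)) +
          ∑ d ∈ (primesProdBelow z).divisors.filter (fun d : ℕ => (d : ℝ) ≤ D), |A.remainder d x|)
    {S : ℕ} (hS : ∀ p : ℕ, p.Prime → #(Ω p) ≤ S)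
    {n₀ : ℕ} (hn₀ : ∀ i, ∀ n : ℕ, n₀ ≤ n → 0 < (f i).eval (n : ℤ))
    {x : ℕ} {z' D : ℝ} (hz' : 2 ≤ z') (hzD : z' ≤ D) (hzβ : β < ⌈z'⌉₊) (hx : 0 ≤ α * x + β)
    (hzy : ⌈z'⌉₊ ≤ (α * x + β).toNat + 1) :
    |(#(((Icc 1 x).filter (fun n : ℕ => ∀ i, 0 < (f i).eval (n : ℤ) ∧
        ∀ p ∈ range ⌈z'⌉₊, p.Prime → ¬ ((p : ℤ) ∣ (f i).eval (n : ℤ)))).filter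
        (fun n : ℕ => ArithmeticFunction.cardFactors (((f m).eval (n : ℤ)).toNat) = 1)) : ℝ) -
      (∏ p ∈ Nat.primesBelow ⌈z'⌉₊, (1 - g p)) *
        #((Icc 1 x).filter (fun n : ℕ => (0 < (f m).eval (n : ℤ) ∧
          ∀ p ∈ range ⌈z'⌉₊, p.Prime → ¬ ((p : ℤ) ∣ (f m).eval (n : ℤ))) ∧
          ArithmeticFunction.cardFactors (((f m).eval (n : ℤ)).toNat) = 1))| ≤
      n₀ + C₀ * Real.exp (-(Real.log D / Real.log z')) * (∏ p ∈ Nat.primesBelow ⌈z'⌉₊, (1 - g p)) *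
          ((#((Icc 1 x).filter (fun n : ℕ => (0 < (f m).eval (n : ℤ) ∧
            ∀ p ∈ range ⌈z'⌉₊, p.Prime → ¬ ((p : ℤ) ∣ (f m).eval (n : ℤ))) ∧
            ArithmeticFunction.cardFactors (((f m).eval (n : ℤ)).toNat) = 1)) : ℝ) +
            (primeCountingAPErr (((α * x + β).toNat : ℕ) : ℝ) α.toNat + ⌈z'⌉₊)) +
        (∑ d ∈ (primesProdBelow z').divisors.filter (fun d : ℕ => (d : ℝ) ≤ D),
            (S : ℝ) ^ ArithmeticFunction.cardDistinctFactors d *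
              primeCountingAPErr (((α * x + β).toNat : ℕ) : ℝ) (α.toNat * d) + D * D * ⌈z'⌉₊) +
        (∏ p ∈ Nat.primesBelow ⌈z'⌉₊, (1 - g p)) *
          (primeCountingAPErr (((α * x + β).toNat : ℕ) : ℝ) α.toNat + ⌈z'⌉₊) := by
  -- abbreviations
  obtain ⟨z, hz⟩ : ∃ z : ℕ, z = ⌈z'⌉₊ := ⟨_, rfl⟩
  obtain ⟨y, hy⟩ : ∃ y : ℕ, y = (α * x + β).toNat := ⟨_, rfl⟩
  rw [← hz] at hzβ hzy ⊢
  rw [← hy] at hzy ⊢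
  obtain ⟨W, hW⟩ : ∃ W : ℝ, W = ∏ p ∈ Nat.primesBelow z, (1 - g p) := ⟨_, rfl⟩
  obtain ⟨Pset, hPset⟩ : ∃ Pset : Finset ℕ, Pset = ((Icc 1 x).filter (fun n : ℕ => ∀ i,
      0 < (f i).eval (n : ℤ) ∧ ∀ p ∈ range z, p.Prime → ¬ ((p : ℤ) ∣ (f i).eval (n : ℤ)))).filter
      (fun n : ℕ => ArithmeticFunction.cardFactors (((f m).eval (n : ℤ)).toNat) = 1) := ⟨_, rfl⟩
  obtain ⟨Qset, hQset⟩ : ∃ Qset : Finset ℕ, Qset = (Icc 1 x).filter (fun n : ℕ =>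
      (0 < (f m).eval (n : ℤ) ∧ ∀ p ∈ range z, p.Prime → ¬ ((p : ℤ) ∣ (f m).eval (n : ℤ))) ∧
        ArithmeticFunction.cardFactors (((f m).eval (n : ℤ)).toNat) = 1) := ⟨_, rfl⟩
  obtain ⟨E₁, hE₁⟩ : ∃ E₁ : ℝ, E₁ = primeCountingAPErr (y : ℝ) α.toNat + z := ⟨_, rfl⟩
  obtain ⟨R, hR⟩ : ∃ R : ℝ, R = ∑ d ∈ (primesProdBelow z').divisors.filter (fun d : ℕ => (d : ℝ) ≤ D),
      (S : ℝ) ^ ArithmeticFunction.cardDistinctFactors d *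
        primeCountingAPErr (y : ℝ) (α.toNat * d) + D * D * z := ⟨_, rfl⟩
  rw [← hW, ← hPset, ← hQset, ← hE₁, ← hR]
  have hQset' : Qset = (Icc 1 x).filter (fun n : ℕ => (0 < α * n + β ∧
      ∀ p ∈ range z, p.Prime → ¬ ((p : ℤ) ∣ α * n + β)) ∧
        ArithmeticFunction.cardFactors (α * n + β).toNat = 1) := by
    rw [hQset]; simp only [hfm]
  have hα'0 : 0 < α.toNat := by omega
  -- the encoding and the sequence
  obtain ⟨N, hN, hN0, hNB⟩ : ∃ N : ℕ → ℕ, (∀ n q : ℕ, q.Prime → (q ∣ N n ↔ q < z ∧ n % q ∈ Ω q)) ∧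
      (∀ n, 0 < N n) ∧ ∀ n, N n ≤ ∏ p ∈ Nat.primesBelow z, p :=
    ⟨fun n => ∏ p ∈ (Nat.primesBelow z).filter (fun p => n % p ∈ Ω p), p,
      fun n q hq => prime_dvd_classProd_iff Ω z n hq, fun n => classProd_pos Ω z n,
      fun n => classProd_le Ω z n⟩
  obtain ⟨B, hB⟩ : ∃ B : ℕ, B = ∏ p ∈ Nat.primesBelow z, p := ⟨_, rfl⟩
  rw [← hB] at hNB
  obtain ⟨Xm, hXm⟩ : ∃ Xm : ℝ,
      Xm = ((Nat.primeCounting y : ℝ) - Nat.primeCounting (z - 1)) / Nat.totient α.toNat := ⟨_, rfl⟩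
  have hXm0 : 0 ≤ Xm := by
    rw [hXm]
    refine div_nonneg (sub_nonneg.mpr ?_) (Nat.cast_nonneg _)
    exact_mod_cast Nat.monotone_primeCounting (by omega : z - 1 ≤ y)
  obtain ⟨A, ha, hsize, hdens⟩ : ∃ A : SieveSequence, (∀ v, A.a v = (#{n ∈ Qset | N n = v} : ℝ)) ∧
      (∀ t, A.size t = Xm) ∧ A.density = g :=
    ⟨⟨fun v => (#{n ∈ Qset | N n = v} : ℝ), fun _ => Nat.cast_nonneg _, fun _ => Xm, g,
      BoundedClassDensity.isMultiplicative_of_apply_eq_prod hg⟩, fun _ => rfl, fun _ => rfl, rfl⟩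
  have hdimA : HasSieveDimension A.density κ K := by rw [hdens]; exact hdim
  have h := hFL A hdimA (B : ℝ) z' D hz' hzD (by rw [hsize]; exact hXm0)
  -- the sifting function
  obtain ⟨Sset, hSset⟩ : ∃ Sset : Finset ℕ,
      Sset = Qset.filter (fun n => ∀ p ∈ Nat.primesBelow z, n % p ∉ Ω p) := ⟨_, rfl⟩
  have hSift : A.sifted B (primesProdBelow z') = #Sset := by
    have hset : Qset.filter (fun n => (N n).Coprime (primesProdBelow z')) = Sset := by
      rw [hSset]
      refine Finset.filter_congr fun n _ => ?_
      rw [coprime_primesProdBelow_iff, ← hz]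
      refine forall₂_congr fun q hq => ?_
      rw [Nat.mem_primesBelow] at hq
      rw [hN n q hq.2]
      exact ⟨fun h1 h2 => h1 ⟨hq.1, h2⟩, fun h1 h2 => h1 h2.2⟩
    rw [sifted_eq ha hN0 hNB, hset]
  -- the main term
  have hV : A.densityProduct (primesProdBelow z') = W := by
    rw [SieveSequence.densityProduct, primeFactors_primesProdBelow, hdens, ← hz, hW]
  have hW0 : 0 < W := by
    rw [hW]
    exact prod_pos fun p hp => sub_pos.mpr (hdim.1 p (Nat.prime_of_mem_primesBelow hp)).2
  -- `S(𝒜, z)` against `P`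
  have hPS1 : #Pset ≤ #Sset := by
    rw [hPset, hSset, hQset]
    refine card_le_card fun n hn => ?_
    rw [mem_filter, mem_filter] at hn
    obtain ⟨⟨hnI, hall⟩, hΩ1⟩ := hn
    rw [mem_filter, mem_filter]
    refine ⟨⟨hnI, hall m, hΩ1⟩, fun p hp hmem => ?_⟩
    rw [hΩ, mem_filter] at hmem
    obtain ⟨-, -, i, -, hi⟩ := hmem
    rw [Nat.mem_primesBelow] at hp
    exact (hall i).2 p (mem_range.mpr hp.1) hp.2 ((dvd_eval_iff_dvd_eval_mod (f i) p n).mpr hi)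
  have hPS2 : #Sset ≤ #Pset + n₀ := by
    calc #Sset ≤ #(Pset ∪ range n₀) := card_le_card fun n hn => ?_
      _ ≤ #Pset + n₀ := (card_union_le _ _).trans (by rw [card_range])
    rw [hSset, hQset, mem_filter, mem_filter] at hn
    obtain ⟨⟨hnI, ⟨-, hrough⟩, hΩ1⟩, hsift⟩ := hn
    rw [mem_union, mem_range, hPset, mem_filter, mem_filter]
    by_cases hnn : n₀ ≤ n
    · refine Or.inl ⟨⟨hnI, fun i => ⟨hn₀ i n hnn, fun p hp hpp hdvd => ?_⟩⟩, hΩ1⟩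
      by_cases him : i = m
      · subst him; exact hrough p hp hpp hdvd
      · refine hsift p (Nat.mem_primesBelow.mpr ⟨mem_range.mp hp, hpp⟩) ?_
        rw [hΩ, mem_filter]
        exact ⟨mem_range.mpr (Nat.mod_lt n hpp.pos),
          fun h' => hrough p hp hpp ((dvd_eval_iff_dvd_eval_mod (f m) p n).mpr h'), i, him,
          (dvd_eval_iff_dvd_eval_mod (f i) p n).mp hdvd⟩
    · exact Or.inr (not_le.mp hnn)
  -- the remainders
  have hRd : ∀ d ∈ (primesProdBelow z').divisors.filter (fun d : ℕ => (d : ℝ) ≤ D),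
      |A.remainder d B| ≤ (S : ℝ) ^ ArithmeticFunction.cardDistinctFactors d *
        primeCountingAPErr (y : ℝ) (α.toNat * d) + d * z := by
    intro d hd
    rw [Finset.mem_filter, Nat.mem_divisors] at hd
    have hsq : Squarefree d := (squarefree_primesProdBelow z').squarefree_of_dvd hd.1.1
    have hdM : ∀ q ∈ d.primeFactors, q < z := fun q hq => by
      rw [hz]
      exact Nat.lt_ceil.mpr ((dvd_primesProdBelow_iff (Nat.prime_of_mem_primeFactors hq) z').mp
        ((Nat.dvd_of_mem_primeFactors hq).trans hd.1.1))
    have hcongr : A.congrSum d B =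
        #(Qset.filter (fun n : ℕ => ∀ q ∈ d.primeFactors, n % q ∈ Ω q)) := by
      have hset : Qset.filter (fun n => d ∣ N n) =
          Qset.filter (fun n : ℕ => ∀ q ∈ d.primeFactors, n % q ∈ Ω q) := by
        refine Finset.filter_congr fun n _ => ?_
        rw [dvd_iff_forall_primeFactors hN hsq]
        exact forall₂_congr fun q hq => and_iff_right (hdM q hq)
      rw [congrSum_eq ha hN0 hNB, hset]
    rw [SieveSequence.remainder, hcongr, hdens, hsize, hQset', hXm, hy]
    rw [hy] at hzy
    exact abs_card_classes_sub_le hf hΩ hΦ hα hfm hαβ hg hS hsq hzβ hx hzy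
  have hD0 : 0 ≤ D := by linarith
  have hcardD : (#((primesProdBelow z').divisors.filter (fun d : ℕ => (d : ℝ) ≤ D)) : ℝ) ≤ D := by
    -- adapted from `IntervalClassSieve.abs_card_sub_le`
    have hsub : (primesProdBelow z').divisors.filter (fun d : ℕ => (d : ℝ) ≤ D) ⊆ Icc 1 ⌊D⌋₊ := by
      intro d hd
      rw [Finset.mem_filter, Nat.mem_divisors] at hd
      rw [Finset.mem_Icc]
      exact ⟨Nat.pos_of_dvd_of_pos hd.1.1 (Nat.pos_of_ne_zero hd.1.2), Nat.le_floor hd.2⟩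
    calc (#((primesProdBelow z').divisors.filter (fun d : ℕ => (d : ℝ) ≤ D)) : ℝ)
        ≤ #(Icc 1 ⌊D⌋₊) := by exact_mod_cast Finset.card_le_card hsub
      _ = ((⌊D⌋₊ : ℕ) : ℝ) := by rw [Nat.card_Icc, Nat.add_sub_cancel]
      _ ≤ D := Nat.floor_le hD0
  have hRsum : ∑ d ∈ (primesProdBelow z').divisors.filter (fun d : ℕ => (d : ℝ) ≤ D),
      |A.remainder d B| ≤ R := by
    have hz0 : (0 : ℝ) ≤ z := Nat.cast_nonneg _
    calc ∑ d ∈ (primesProdBelow z').divisors.filter (fun d : ℕ => (d : ℝ) ≤ D), |A.remainder d B|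
        ≤ ∑ d ∈ (primesProdBelow z').divisors.filter (fun d : ℕ => (d : ℝ) ≤ D),
            ((S : ℝ) ^ ArithmeticFunction.cardDistinctFactors d *
              primeCountingAPErr (y : ℝ) (α.toNat * d) + D * z) := by
          refine sum_le_sum fun d hd => (hRd d hd).trans (add_le_add le_rfl ?_)
          exact mul_le_mul_of_nonneg_right (Finset.mem_filter.mp hd).2 hz0
      _ = (∑ d ∈ (primesProdBelow z').divisors.filter (fun d : ℕ => (d : ℝ) ≤ D),
            (S : ℝ) ^ ArithmeticFunction.cardDistinctFactors d *
              primeCountingAPErr (y : ℝ) (α.toNat * d)) +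
            #((primesProdBelow z').divisors.filter (fun d : ℕ => (d : ℝ) ≤ D)) * (D * z) := by
          rw [sum_add_distrib, sum_const, nsmul_eq_mul]
      _ ≤ R := by
          rw [hR, mul_assoc D D]
          gcongr
  -- `Q` against the size `X`
  have hQX : |(#Qset : ℝ) - Xm| ≤ E₁ := by
    have hc' : ∀ q ∈ (1 : ℕ).primeFactors, ¬ ((q : ℤ) ∣ α * ((0 : ℕ) : ℤ) + β) := by
      simp [Nat.primeFactors_one]
    obtain ⟨u, hu⟩ := isUnit_linear_class hα hαβ one_ne_zero hc'
    haveI : NeZero (α.toNat * 1) := ⟨by omega⟩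
    have ha1 : (((u : ZMod (α.toNat * 1)).val : ℕ) : ZMod (α.toNat * 1)) =
        ((α * ((0 : ℕ) : ℤ) + β : ℤ) : ZMod (α.toNat * 1)) := by rw [ZMod.natCast_zmod_val, hu]
    have hcount := card_filter_mod_eq hα Nat.zero_lt_one hzβ hx ha1
    rw [← hy, ← hQset', filter_true_of_mem fun n _ => Nat.mod_one n] at hcount
    have hb := abs_card_sub_le hzy u
    rw [← hcount] at hb
    simpa only [mul_one, ← hXm, ← hE₁] using hb
  -- combination
  have hP1 : (#Pset : ℝ) ≤ #Sset := by exact_mod_cast hPS1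
  have hP2 : (#Sset : ℝ) ≤ #Pset + n₀ := by exact_mod_cast hPS2
  have hE₁0 : 0 ≤ E₁ := by
    rw [hE₁]; exact add_nonneg (primeCountingAPErr_nonneg _ _) (Nat.cast_nonneg _)
  have hXQ : Xm ≤ #Qset + E₁ := by have := (abs_le.mp hQX).1; linarith
  set e : ℝ := Real.exp (-(Real.log D / Real.log z')) with he
  have he0 : 0 ≤ e := Real.exp_nonneg _
  rw [hSift, hsize, hV] at h
  have hn0 : (0 : ℝ) ≤ n₀ := Nat.cast_nonneg _
  have h1 : |(#Pset : ℝ) - #Sset| ≤ n₀ := abs_sub_le_iff.mpr ⟨by linarith, by linarith⟩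
  have h2 : |(#Sset : ℝ) - Xm * W| ≤ C₀ * e * W * (#Qset + E₁) + R := by
    refine h.trans (add_le_add ?_ hRsum)
    calc C₀ * Xm * W * e = C₀ * e * W * Xm := by ring
      _ ≤ C₀ * e * W * (#Qset + E₁) :=
          mul_le_mul_of_nonneg_left hXQ (mul_nonneg (mul_nonneg hC₀ he0) hW0.le)
  have h3 : |Xm * W - W * #Qset| ≤ W * E₁ := by
    rw [show Xm * W - W * #Qset = W * ((#Qset : ℝ) - Xm) * (-1) by ring, abs_mul, abs_mul,
      abs_of_pos hW0, abs_neg, abs_one, mul_one]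
    exact mul_le_mul_of_nonneg_left hQX hW0.le
  calc |(#Pset : ℝ) - W * #Qset|
      ≤ |(#Pset : ℝ) - #Sset| + |(#Sset : ℝ) - W * #Qset| := abs_sub_le _ _ _
    _ ≤ |(#Pset : ℝ) - #Sset| + (|(#Sset : ℝ) - Xm * W| + |Xm * W - W * #Qset|) :=
        add_le_add le_rfl (abs_sub_le _ _ _)
    _ ≤ n₀ + (C₀ * e * W * (#Qset + E₁) + R + W * E₁) := add_le_add h1 (by linarith)
    _ = _ := by ring

end SieveDecoupling

/-- **Sub-goal (the decoupling sieve at a fixed height)** of the stub `stub_sieveDecouplingPrime`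
(crux stmt-Parity-15629, line `birth`): the inequality of `SieveDecoupling.sieve_at` with the classes
`Ω p`, `Φ p` written out. [folklore] -/
theorem stub_decouplingSieveAt :
    ∀ (k : ℕ) (f : Fin k → Polynomial ℤ), Literature.NumberTheory.Sieve.IsBatemanHornSystem f → ∀ (m
    : Fin k) (α β : ℤ), 0 < α → (∀ n : ℤ, (f m).eval n = α * n + β) → (∀ p : ℕ, p.Prime → (p : ℤ) ∣
    α → ¬ ((p : ℤ) ∣ β)) → ∀ (g : ArithmeticFunction ℝ), (∀ d : ℕ, d ≠ 0 → g d = ∏ p ∈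
    d.primeFactors, ((((Finset.range p).filter (fun c : ℕ => ¬ ((p : ℤ) ∣ (f m).eval (c : ℤ)) ∧ ∃ i,
    i ≠ m ∧ (p : ℤ) ∣ (f i).eval (c : ℤ))).card : ℕ) : ℝ) / ((((Finset.range p).filter (fun c : ℕ =>
    ¬ ((p : ℤ) ∣ (f m).eval (c : ℤ)))).card : ℕ) : ℝ)) → ∀ (κ K C₀ : ℝ),
    Literature.NumberTheory.Sieve.HasSieveDimension g κ K → 0 ≤ C₀ → (∀ A :
    Literature.NumberTheory.Sieve.SieveSequence, Literature.NumberTheory.Sieve.HasSieveDimension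
    A.density κ K → ∀ x z D : ℝ, 2 ≤ z → z ≤ D → 0 ≤ A.size x → |A.sifted x
    (Literature.NumberTheory.Sieve.primesProdBelow z) - A.size x * A.densityProduct
    (Literature.NumberTheory.Sieve.primesProdBelow z)| ≤ C₀ * A.size x * A.densityProduct
    (Literature.NumberTheory.Sieve.primesProdBelow z) * Real.exp (-(Real.log D / Real.log z)) + ∑ d
    ∈ (Literature.NumberTheory.Sieve.primesProdBelow z).divisors.filter (fun d : ℕ => (d : ℝ) ≤ D),
    |A.remainder d x|) → ∀ (S : ℕ), (∀ p : ℕ, p.Prime → ((Finset.range p).filter (fun c : ℕ => ¬ ((p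
    : ℤ) ∣ (f m).eval (c : ℤ)) ∧ ∃ i, i ≠ m ∧ (p : ℤ) ∣ (f i).eval (c : ℤ))).card ≤ S) → ∀ (n₀ : ℕ),
    (∀ i, ∀ n : ℕ, n₀ ≤ n → 0 < (f i).eval (n : ℤ)) → ∀ (x : ℕ) (z' D : ℝ), 2 ≤ z' → z' ≤ D → β <
    ⌈z'⌉₊ → 0 ≤ α * x + β → ⌈z'⌉₊ ≤ (α * x + β).toNat + 1 → |(((((Finset.Icc 1 x).filter (fun n : ℕ
    => ∀ i, 0 < (f i).eval (n : ℤ) ∧ ∀ p ∈ Finset.range ⌈z'⌉₊, p.Prime → ¬ ((p : ℤ) ∣ (f i).eval (n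
    : ℤ)))).filter (fun n : ℕ => ArithmeticFunction.cardFactors (((f m).eval (n : ℤ)).toNat) =
    1)).card : ℕ) : ℝ) - (∏ p ∈ Nat.primesBelow ⌈z'⌉₊, (1 - g p)) * ((((Finset.Icc 1 x).filter (fun
    n : ℕ => (0 < (f m).eval (n : ℤ) ∧ ∀ p ∈ Finset.range ⌈z'⌉₊, p.Prime → ¬ ((p : ℤ) ∣ (f m).eval
    (n : ℤ))) ∧ ArithmeticFunction.cardFactors (((f m).eval (n : ℤ)).toNat) = 1)).card : ℕ) : ℝ)| ≤
    n₀ + C₀ * Real.exp (-(Real.log D / Real.log z')) * (∏ p ∈ Nat.primesBelow ⌈z'⌉₊, (1 - g p)) *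
    (((((Finset.Icc 1 x).filter (fun n : ℕ => (0 < (f m).eval (n : ℤ) ∧ ∀ p ∈ Finset.range ⌈z'⌉₊,
    p.Prime → ¬ ((p : ℤ) ∣ (f m).eval (n : ℤ))) ∧ ArithmeticFunction.cardFactors (((f m).eval (n :
    ℤ)).toNat) = 1)).card : ℕ) : ℝ) + (Literature.NumberTheory.Sieve.primeCountingAPErr (((α * x +
    β).toNat : ℕ) : ℝ) α.toNat + ⌈z'⌉₊)) + (∑ d ∈ (Literature.NumberTheory.Sieve.primesProdBelow
    z').divisors.filter (fun d : ℕ => (d : ℝ) ≤ D), (S : ℝ) ^ ArithmeticFunction.cardDistinctFactors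
    d * Literature.NumberTheory.Sieve.primeCountingAPErr (((α * x + β).toNat : ℕ) : ℝ) (α.toNat * d)
    + D * D * ⌈z'⌉₊) + (∏ p ∈ Nat.primesBelow ⌈z'⌉₊, (1 - g p)) *
    (Literature.NumberTheory.Sieve.primeCountingAPErr (((α * x + β).toNat : ℕ) : ℝ) α.toNat + ⌈z'⌉₊) :=
  fun _ f hf m _ _ hα hfm hαβ _ hg _ _ _ hdim hC₀ hFL _ hS _ hn₀ _ _ _ hz' hzD hzβ hx hzy =>
    SieveDecoupling.sieve_at hf (m := m)
      (Ω := fun p => (Finset.range p).filter (fun c : ℕ => ¬ ((p : ℤ) ∣ (f m).eval (c : ℤ)) ∧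
        ∃ i, i ≠ m ∧ (p : ℤ) ∣ (f i).eval (c : ℤ)))
      (Φ := fun p => (Finset.range p).filter (fun c : ℕ => ¬ ((p : ℤ) ∣ (f m).eval (c : ℤ))))
      (fun _ => rfl) (fun _ => rfl) hα hfm hαβ hg hdim hC₀ hFL hS hn₀ hz' hzD hzβ hx hzy

end Summit.Parity.BatemanHorn.Cruxes.OddSectorShareLinear.Birth

end
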